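import Mathlib
import Literature.Combinatorics.Additive.TripleProductProperty

/-!
# Evaluation helpers for the small-`n` TPP census files

* `pdN n s` — the permutation of `Fin n` whose image vector is the digit string `s`
  (`pdN 8 "10325476" = (0 1)(2 3)(4 5)(6 7)`), a *computable* `Equiv` (forward map from the digits,
  backward map by search, the two inverse laws decided at evaluation; the identity if `s` is not a
  permutation — never the case in the census files).  Lets witness / certificate files list hundreds
  of permutations in a few kilobytes and evaluate them with `decide` / `native_decide`.
* `tpp_of_closed3` — the triple product property of `(S, T, U)` from: each of `S, T, U` is closed
  under `a b⁻¹` (so contains its own right quotient set — subgroups, in the census), and the only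
  `(s, t) ∈ S × T` with `(s t)⁻¹ ∈ U` is `(1, 1)`.  This is the quotient-set form of the TPP
  (Cohn–Umans 2003, Def. 2.1) specialised to quotient-closed sets; its hypotheses cost
  `|S|²+|T|²+|U|²` and `|S||T|` membership tests instead of the `|S|²|T|²|U|²` of the definition.
-/

namespace Summit.MatrixMultiplication.MatrixMultiplication.Theorems.HyperoctahedralThreshold.Negative

set_option linter.dupNamespace false

open Literature.Combinatorics.Additive

/-- Computable permutation of `Fin n` from a forward and a backward map (the identity if they are not
mutually inverse). [folklore] -/
def mkPermN {n : ℕ} (f g : Fin n → Fin n) : Equiv.Perm (Fin n) :=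
  if h : (∀ x, g (f x) = x) ∧ (∀ x, f (g x) = x) then ⟨f, g, h.1, h.2⟩ else 1

/-- Digit `i` of `s` as an element of `Fin n` (`n > 0`). [folklore] -/
def digN (n : ℕ) [NeZero n] (s : String) (i : ℕ) : Fin n :=
  Fin.ofNat n ((s.toList.getD i '0').toNat - '0'.toNat)

/-- The permutation of `Fin n` (`1 ≤ n ≤ 10`) with image string `s`, e.g.
`pdN 8 "10325476" = (0 1)(2 3)(4 5)(6 7)`. [folklore] -/
def pdN (n : ℕ) [NeZero n] (s : String) : Equiv.Perm (Fin n) :=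
  mkPermN (fun x => digN n s x.val)
    (fun y => ((List.finRange n).find? fun x => digN n s x.val = y).getD y)

/-- **TPP for quotient-closed sets.**  If `S, T, U` are closed under `a b⁻¹` and the only pair
`(s, t) ∈ S × T` with `(s t)⁻¹ ∈ U` is `(1, 1)`, then `(S, T, U)` has the triple product property.
[cite: CohnUmans2003, Def. 2.1] -/
theorem tpp_of_closed3 {G : Type*} [Group G] [DecidableEq G] {S T U : Finset G}
    (hS : ∀ a ∈ S, ∀ b ∈ S, a * b⁻¹ ∈ S) (hT : ∀ a ∈ T, ∀ b ∈ T, a * b⁻¹ ∈ T)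
    (hU : ∀ a ∈ U, ∀ b ∈ U, a * b⁻¹ ∈ U)
    (h : ∀ s ∈ S, ∀ t ∈ T, (s * t)⁻¹ ∈ U → s = 1 ∧ t = 1) :
    TripleProductProperty S T U := by
  intro s hs s' hs' t ht t' ht' u hu u' hu' heq
  have hq0 : s * s'⁻¹ ∈ S := hS s hs s' hs'
  have hq1 : t * t'⁻¹ ∈ T := hT t ht t' ht'
  have hq2 : u * u'⁻¹ ∈ U := hU u hu u' hu'
  have hinv : (s * s'⁻¹ * (t * t'⁻¹))⁻¹ = u * u'⁻¹ := (eq_inv_of_mul_eq_one_right heq).symm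
  obtain ⟨e0, e1⟩ := h _ hq0 _ hq1 (hinv ▸ hq2)
  have e2 : u * u'⁻¹ = 1 := by rw [← hinv, e0, e1]; simp
  exact ⟨mul_inv_eq_one.1 e0, mul_inv_eq_one.1 e1, mul_inv_eq_one.1 e2⟩

end Summit.MatrixMultiplication.MatrixMultiplication.Theorems.HyperoctahedralThreshold.Negative
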